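import Mathlib
import Summits.Ventures.Crystal3D.Theorems.StickyWulffConstantStackingLiminfLayerChainV4Defs
import Summits.Ventures.Crystal3D.Theorems.StickyWulffConstantStackingLiminfMollifierSmooth
import Summits.Ventures.Crystal3D.Theorems.StickyWulffConstantStackingLiminfKernelBounds
import HarnessLib

/-!
# The lateral kernel's gradient in `L¹` (stub (B) `MollifiedUpper`, line LayerChain v4, crux `StackingLiminf`,
# stmt-Ventures-19145): `‖∂_c η_L‖₁ ≤ C_η ‖c‖ / L`

Cell `crystal3d-full`, venture `Summits/Ventures/Crystal3D`.  BLUEPRINT-v4B (S3), the constant in front of the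
skew: after the integration by parts of `fderiv_lateral_apply_of_horizontal` (…LateralCalculus), the skew term
of the two-phase pairing is `≤ ‖∂_c η_L‖_{L¹(ℝ²)} ‖E‖_{L¹(ℝ³)}`, and this file gives `‖∂_c η_L‖₁ ≤ C_η ‖c‖ / L`
with an absolute (existential) `C_η`:
* `contDiff_eta` — the explicit lateral kernel `η_L(z) = (4/πL²)(1 − |z|²/L²)₊³` is `C²`;
* `eta_eq_scale`, `fderiv_eta_apply_eq_scale` — `η_L(z) = L⁻² η_1(z/L)`, `Dη_L(z) c = L⁻³ Dη_1(z/L) c`;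
* `tsupport_eta_subset`, `fderiv_eta_eq_zero` — `Dη_L` vanishes off the sup-norm ball of radius `L`;
* `exists_eta_grad_const` — `∃ C_η ≥ 0, ∀ L > 0, ∀ c, ∫ |Dη_L(z) c| dz ≤ C_η ‖c‖ / L`.
WHAT THIS IS NOT: stub (B); rung F-C1 not moved.
-/

noncomputable section

namespace Summit.Ventures.Crystal3D.Theorems

open MeasureTheory Set Function Metric Filter Topology
open Summit.Ventures.Crystal3D.Cruxes.StackingLiminf.LayerChainV4 (eta)

/-- The lateral kernel is `C²`. -/
theorem contDiff_eta (L : ℝ) : ContDiff ℝ 2 (eta L) := by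
  have h : eta L = fun z : ℝ × ℝ =>
      4 / (Real.pi * L ^ 2) * ((fun t : ℝ => max 0 t ^ 3) (1 - (z.1 ^ 2 + z.2 ^ 2) / L ^ 2)) := by
    funext z; rfl
  rw [h]
  refine contDiff_const.mul (contDiff_two_maxZero_cube.comp ?_)
  fun_prop

/-- Scaling of the lateral kernel: `η_L(z) = L⁻² η_1(z/L)`. -/
theorem eta_eq_scale {L : ℝ} (hL : L ≠ 0) (z : ℝ × ℝ) : eta L z = (L ^ 2)⁻¹ * eta 1 (L⁻¹ • z) := by
  unfold eta
  simp only [Prod.smul_fst, Prod.smul_snd, smul_eq_mul, one_pow, div_one, mul_one]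
  have : 1 - ((L⁻¹ * z.1) ^ 2 + (L⁻¹ * z.2) ^ 2) = 1 - (z.1 ^ 2 + z.2 ^ 2) / L ^ 2 := by
    field_simp
  rw [this]
  field_simp

/-- Scaling of the derivative of the lateral kernel: `Dη_L(z) c = L⁻³ Dη_1(z/L) c`. -/
theorem fderiv_eta_apply_eq_scale {L : ℝ} (hL : 0 < L) (z c : ℝ × ℝ) :
    fderiv ℝ (eta L) z c = (L ^ 3)⁻¹ * fderiv ℝ (eta 1) (L⁻¹ • z) c := by
  have hfun : eta L = fun z => (L ^ 2)⁻¹ * eta 1 (L⁻¹ • z) := by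
    funext z; exact eta_eq_scale hL.ne' z
  have hsc : HasFDerivAt (fun z : ℝ × ℝ => L⁻¹ • z) (L⁻¹ • ContinuousLinearMap.id ℝ (ℝ × ℝ)) z :=
    (hasFDerivAt_id (𝕜 := ℝ) z).const_smul L⁻¹
  have he1 : HasFDerivAt (eta 1) (fderiv ℝ (eta 1) (L⁻¹ • z)) (L⁻¹ • z) :=
    ((contDiff_eta 1).differentiable (by norm_num)).differentiableAt.hasFDerivAt
  have hcomp := (he1.comp z hsc).const_mul ((L ^ 2)⁻¹)
  have : HasFDerivAt (eta L) (((L ^ 2)⁻¹ : ℝ) • (fderiv ℝ (eta 1) (L⁻¹ • z)).comp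
      (L⁻¹ • ContinuousLinearMap.id ℝ (ℝ × ℝ))) z := by
    rw [hfun]; exact hcomp
  rw [this.fderiv]
  simp
  ring

/-- The closed support of the lateral kernel lies in the (sup-norm) ball of radius `L`. -/
theorem tsupport_eta_subset {L : ℝ} (hL : 0 < L) : tsupport (eta L) ⊆ closedBall (0 : ℝ × ℝ) L := by
  refine closure_minimal (fun z hz => ?_) isClosed_closedBall
  rw [mem_closedBall, dist_zero_right]
  by_contra h
  rw [not_le, Prod.norm_def, lt_max_iff, Real.norm_eq_abs, Real.norm_eq_abs] at h
  exact hz (eta_eq_zero_of_coord hL (h.imp le_of_lt le_of_lt))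

/-- Outside the ball of radius `L` the derivative of the lateral kernel vanishes. -/
theorem fderiv_eta_eq_zero {L : ℝ} (hL : 0 < L) {z : ℝ × ℝ} (hz : L < ‖z‖) : fderiv ℝ (eta L) z = 0 := by
  have hnot : z ∉ tsupport (eta L) := by
    intro h
    have := tsupport_eta_subset hL h
    rw [mem_closedBall, dist_zero_right] at this
    linarith
  exact notMem_support.mp fun h => hnot (support_fderiv_subset ℝ h)

/-- **The gradient of the lateral kernel in `L¹`**: `∃ C_η ≥ 0, ∀ L > 0, ∀ c, ∫ |Dη_L(z) c| dz ≤ C_η ‖c‖ / L`. -/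
theorem exists_eta_grad_const : ∃ C : ℝ, 0 ≤ C ∧ ∀ L : ℝ, 0 < L → ∀ c : ℝ × ℝ,
    ∫ z : ℝ × ℝ, |fderiv ℝ (eta L) z c| ≤ C * ‖c‖ / L := by
  -- a bound on the gradient of `η_1`
  have hc' : Continuous (fderiv ℝ (eta 1)) := (contDiff_eta 1).continuous_fderiv (by norm_num)
  obtain ⟨C₁, hC₁⟩ := hc'.bounded_above_of_compact_support
    ((PlateauHeight.hasCompactSupport_eta one_pos).fderiv (𝕜 := ℝ))
  have hC₁0 : 0 ≤ C₁ := le_trans (norm_nonneg _) (hC₁ 0)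
  refine ⟨4 * C₁, by positivity, fun L hL c => ?_⟩
  -- the ball of radius `L` (a square) has volume `4L²`
  set B : Set (ℝ × ℝ) := closedBall (0 : ℝ × ℝ) L with hB
  have hBvol : (volume B).toReal = 2 * L * (2 * L) := by
    rw [hB, show (0 : ℝ × ℝ) = ((0 : ℝ), (0 : ℝ)) from rfl, ← closedBall_prod_same,
      Measure.volume_eq_prod, Measure.prod_prod, Real.volume_closedBall, ENNReal.toReal_mul,
      ENNReal.toReal_ofReal (by positivity)]
  have hBfin : volume B < ⊤ := by rw [hB]; exact measure_closedBall_lt_top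
  -- pointwise bound
  have hpt : ∀ z : ℝ × ℝ, |fderiv ℝ (eta L) z c| ≤ B.indicator (fun _ => (L ^ 3)⁻¹ * C₁ * ‖c‖) z := by
    intro z
    by_cases hz : z ∈ B
    · rw [indicator_of_mem hz, fderiv_eta_apply_eq_scale hL, abs_mul, abs_of_pos (by positivity),
        mul_assoc]
      refine mul_le_mul_of_nonneg_left ?_ (by positivity)
      rw [← Real.norm_eq_abs]
      exact le_trans (ContinuousLinearMap.le_opNorm _ _) (mul_le_mul_of_nonneg_right (hC₁ _) (norm_nonneg _))
    · rw [indicator_of_notMem hz]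
      rw [hB, mem_closedBall, dist_zero_right, not_le] at hz
      rw [fderiv_eta_eq_zero hL hz]
      simp
  calc ∫ z : ℝ × ℝ, |fderiv ℝ (eta L) z c|
      ≤ ∫ z : ℝ × ℝ, B.indicator (fun _ => (L ^ 3)⁻¹ * C₁ * ‖c‖) z := by
        refine integral_mono_of_nonneg (Eventually.of_forall fun z => abs_nonneg _) ?_
          (Eventually.of_forall hpt)
        exact (integrable_indicator_iff isClosed_closedBall.measurableSet).2
          ((integrableOn_const_iff).2 (Or.inr hBfin))
    _ = (volume B).toReal * ((L ^ 3)⁻¹ * C₁ * ‖c‖) := by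
        rw [integral_indicator_const _ isClosed_closedBall.measurableSet, smul_eq_mul, measureReal_def]
    _ = 4 * C₁ * ‖c‖ / L := by rw [hBvol]; field_simp; ring

end Summit.Ventures.Crystal3D.Theorems

end
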